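import Summits.Langlands.Langlands.Theses.SkinnerWilesDefectOne
import Literature.NumberTheory.Automorphic.OrdinaryCompletedCohomologyGL
import Literature.NumberTheory.Automorphic.AlgebraicityTwist
import Literature.NumberTheory.Automorphic.CentralCharacterArchTwist
import HarnessLib

/-!
# Route `SkinnerWilesDefectOne`, crux `ProModularOrdinaryClassical` (stmt-Langlands-12921), line
# `top-degree-exact-control`: stub 4, the unramified Satake dictionary

Proves VERBATIM the registered stub `stub_satakeDictionary` of the lead's checked skeleton
`Cruxes/ProModularOrdinaryClassical/Lines/top-degree-exact-control.lean` (rev 2): if the `ℚ̄_p`-point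
`x` of Hida's ordinary big Hecke algebra `𝕋^{S,ord}(𝒰)` of `GL₂/F` is associated with `ρ`
(`TameLevel.IsOrdAssociated`: at every `w ∉ S`, `ρ` is unramified and every ARITHMETIC Frobenius has
characteristic polynomial `heckeFrobPoly 2 q_w (x ∘ T_{w,·}) = X² - x(T_{w,1}) X + q_w x(T_{w,2})`) and
its eigenvalues are those of a regular algebraic cuspidal `π₀` in the normalisation of
`HasSatakeParamAt` (`ι x(T_{w,1}) = q_w^{1/2} e₁(α_w)`, `ι x(T_{w,2}) = e₂(α_w)`) at almost all `w`,
then there is an `L`-algebraic cuspidal `π` with the summit's `SatakeFrobCompatibleAt ι π ρ v`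
(`∃ β`, `π` has Satake parameter `β` at `v`, `ρ` unramified at `v`, arithmetic Frobenius polynomial
`arithFrobPolyOfSatake ι q_v 1 β = ∏ (X - ι⁻¹(β_j⁻¹))`) at almost all `v`.

## The dictionary (conventions verified here, in Lean)

Through `ι` the arithmetic-Frobenius roots are `q^{1/2} α₁, q^{1/2} α₂`
(`X² - q^{1/2} e₁(α) X + q e₂(α)`), so `β = {(q^{1/2} α₁)⁻¹, (q^{1/2} α₂)⁻¹} = q^{-1/2} α⁻¹`:
`π = π₀^∨ ⊗ |det|^{1/2}`. For `GL₂` the contragredient is the twist by the inverse central character: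
with `ω = ω_{π₀}` (`AutomorphicRepData.exists_centralCharacter`: the centre acts through `ω` and
`ω(ϖ_w) = e₂(α_w) = α₁ α₂`), `π₁ := π₀ ⊗ (ω⁻¹ ∘ det)` (`exists_cuspidalAutomorphicRepData_twist_hecke`)
has Satake parameters `(α₁α₂)⁻¹ α = {α₂⁻¹, α₁⁻¹}` at almost all `w`
(`eventually_hasSatakeParamAt_of_map_mulChar_detTwist`) and is REGULAR ALGEBRAIC
(`IsRegularAlgebraic.of_map_mulChar_detTwist_centralInv`, file `CentralCharacterArchTwist`: its
infinity type is `{(a - A_σ, b - A_σ̄)}`, `A_σ = ∑ a_{σ,i} ∈ ℤ`); then Buzzard–Gee's half twist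
`π := π₁ ⊗ |det|^{1/2}` (`CuspidalAutomorphicRepData.exists_twist_isRegular_isLAlgebraic`) is
`L`-algebraic with Satake parameters `q^{-1/2} · {α₂⁻¹, α₁⁻¹}`
(`HasSatakeParamAt.of_map_mulChar_detTwist_of_cpow`). The polynomial identity
`heckeFrobPoly 2 q a = arithFrobPolyOfSatake ι q 1 β` is `heckeFrobPoly_two_eq_arithFrobPolyOfSatake`
(both sides map under `ι` to `(X - q^{1/2} α₁)(X - q^{1/2} α₂)`; Satake entries are non-zero because
`α₁ α₂ = ω(ϖ_w) ∈ ℂˣ`). `IsOrdAssociated` is stated at every `w ∉ 𝒰.bad` (finite) with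
`q_w = Ideal.absNorm w = w.residueCard` (definitional); the three cofinite sets are intersected.
No contragredient fact is used.

References: BuzzardGeeLMS2014 Def. 3.1.1, §5.3; BorelJacquet1979 5.7; GeeNewton2020 §3.3;
Clozel1990 §1, §3.3.
-/

noncomputable section

namespace Summit.Langlands.Langlands.Cruxes.ProModularOrdinaryClassical.TopDegreeExactControl

set_option linter.dupNamespace false

open Literature.NumberTheory.Automorphic Literature.NumberTheory.GaloisRepresentations
open Literature.NumberTheory.Automorphic.BigHeckeGLn
open NumberField IsDedekindDomain Filter Polynomial

/-! ### Bookkeeping: pairs, the half-twist exponent, Hecke characters -/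

/-- `e₁{x, y} = x + y`. [folklore] -/
theorem esymm_one_pair (x y : ℂ) : ({x, y} : Multiset ℂ).esymm 1 = x + y := by
  simp [Multiset.esymm, Multiset.powersetCard_one, Multiset.insert_eq_cons]
  ring

/-- `e₂{x, y} = x y`. [folklore] -/
theorem esymm_two_pair (x y : ℂ) : ({x, y} : Multiset ℂ).esymm 2 = x * y := by
  simp [Multiset.esymm, Multiset.powersetCard_one, Multiset.insert_eq_cons, Multiset.powersetCard_cons]

/-- `∏ {x, y} = x y`. [folklore] -/
theorem prod_pair (x y : ℂ) : ({x, y} : Multiset ℂ).prod = x * y := by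
  simp [Multiset.insert_eq_cons]

/-- The Buzzard–Gee half-twist factor for `n = 2`: `q^{-(2-1)/2} · q^{1/2} = 1`. [folklore] -/
theorem halfTwist_mul_sqrt {q : ℕ} (hq : 0 < q) :
    (q : ℂ) ^ (-(((((2 : ℕ) : ℝ) - 1) / 2 : ℝ) : ℂ)) * ((Real.sqrt q : ℝ) : ℂ) = 1 := by
  have hq' : (0 : ℝ) < q := by exact_mod_cast hq
  have e : ((((2 : ℕ) : ℝ) - 1) / 2 : ℝ) = (1 / 2 : ℝ) := by norm_num
  rw [e, ← Complex.ofReal_natCast, ← Complex.ofReal_neg, ← Complex.ofReal_cpow hq'.le, ← Complex.ofReal_mul,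
    Real.sqrt_eq_rpow, ← Real.rpow_add hq', show (-(1 / 2) + 1 / 2 : ℝ) = 0 by norm_num, Real.rpow_zero,
    Complex.ofReal_one]

/-- `χ⁻¹(ϖ_v) = χ(ϖ_v)⁻¹`. [folklore] -/
theorem valueAtUniformizer_inv {K : Type} [Field K] [NumberField K] (χ : HeckeCharacter K)
    (v : HeightOneSpectrum (𝓞 K)) : χ⁻¹.valueAtUniformizer v = (χ.valueAtUniformizer v)⁻¹ := by
  change (((χ⁻¹).localComponent v (HeckeCharacter.uniformizer K v) : ℂˣ) : ℂ) =
    (((χ.localComponent v (HeckeCharacter.uniformizer K v)) : ℂˣ) : ℂ)⁻¹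
  rw [HeckeCharacter.localComponent_apply, HeckeCharacter.localComponent_apply, HeckeCharacter.inv_apply,
    Units.val_inv_eq_inv_val]

/-- `χ(ϖ_v) ≠ 0` (a unit of `ℂ`). [folklore] -/
theorem valueAtUniformizer_ne_zero {K : Type} [Field K] [NumberField K] (χ : HeckeCharacter K)
    (v : HeightOneSpectrum (𝓞 K)) : χ.valueAtUniformizer v ≠ 0 :=
  Units.ne_zero _

/-! ### The polynomial identity: `𝕋^{ord}`-association ↔ `arithFrobPolyOfSatake ι q 1 (q^{-1/2} α⁻¹)` -/

/-- The rank-two Hecke–Frobenius polynomial is `X² − a₁ X + q a₂` (as in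
`ReducibleOrdinaryProModular.Negative.heckeFrobPoly_two`, restated to keep the imports minimal).
[folklore] -/
theorem heckeFrobPoly_two {R : Type*} [CommRing R] (q : ℕ) (a : ℕ → R) :
    heckeFrobPoly 2 q a = X ^ 2 - C (a 1) * X + C ((q : R) * a 2) := by
  have h : Finset.Icc 1 2 = {1, 2} := by decide
  rw [heckeFrobPoly, h, Finset.sum_insert (by decide), Finset.sum_singleton]
  norm_num
  abel

/-- `(X - u)(X - v) = X² - (u + v) X + u v` in `ℂ[X]`. [folklore] -/
theorem X_sub_C_mul_X_sub_C (u v : ℂ) :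
    (X - C u) * (X - C v) = X ^ 2 - C (u + v) * X + C (u * v) := by
  simp only [map_add, map_mul]
  ring

/-- **The unramified dictionary for `GL₂`.** Let `a₁, a₂ ∈ ℚ̄_p` with `ι a₁ = q^{1/2}(α₁ + α₂)`,
`ι a₂ = α₁ α₂` (the `T_{w,1}`, `T_{w,2}`-eigenvalues of a point matching the Satake parameter `{α₁, α₂}`
in the normalisation `T_{w,i} ↦ q^{i(2-i)/2} e_i`), `α₁ α₂ ≠ 0`, `c₁ α₁ α₂ = 1` and `c₂ q^{1/2} = 1`.
Then the Hecke–Frobenius polynomial `X² - a₁ X + q a₂` of ARITHMETIC Frobenius (`heckeFrobPoly 2 q a`)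
is `arithFrobPolyOfSatake ι q 1 β` for `β = c₂ c₁ {α₁, α₂} = q^{-1/2}{α₂⁻¹, α₁⁻¹}`: both map under `ι`
to `(X - q^{1/2} α₁)(X - q^{1/2} α₂)`. [cite: BuzzardGeeLMS2014, Conj. 3.2.1 and Rem. 3.2.5]
[cite: GeeNewton2020, §3.3, Conj. 3.3.2] -/
theorem heckeFrobPoly_two_eq_arithFrobPolyOfSatake {p : ℕ} [Fact p.Prime] (ι : PadicAlgCl p ≃+* ℂ)
    (q : ℕ) (a : ℕ → PadicAlgCl p) {α₁ α₂ c₁ c₂ : ℂ}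
    (h1 : ι (a 1) = ((Real.sqrt q : ℝ) : ℂ) * (α₁ + α₂)) (h2 : ι (a 2) = α₁ * α₂)
    (hα₁ : α₁ ≠ 0) (hα₂ : α₂ ≠ 0) (hc₁ : c₁ * (α₁ * α₂) = 1) (hc₂ : c₂ * ((Real.sqrt q : ℝ) : ℂ) = 1) :
    heckeFrobPoly 2 q a =
      arithFrobPolyOfSatake ι q 1 ((({α₁, α₂} : Multiset ℂ).map (c₁ * ·)).map (c₂ * ·)) := by
  apply Polynomial.map_injective (ι : PadicAlgCl p →+* ℂ) ι.injective
  -- the left-hand side through `ι`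
  have hL : (heckeFrobPoly 2 q a).map (ι : PadicAlgCl p →+* ℂ) =
      X ^ 2 - C (((Real.sqrt q : ℝ) : ℂ) * (α₁ + α₂)) * X + C ((q : ℂ) * (α₁ * α₂)) := by
    rw [heckeFrobPoly_two]
    simp only [Polynomial.map_add, Polynomial.map_sub, Polynomial.map_mul, Polynomial.map_pow, map_X,
      map_C, RingHom.coe_coe, map_mul, map_natCast, Polynomial.map_natCast, h1, h2]
  -- the right-hand side through `ι`
  have hc₂' : c₂ ≠ 0 := left_ne_zero_of_mul_eq_one hc₂
  have hs : ((Real.sqrt q : ℝ) : ℂ) = c₂⁻¹ := (eq_inv_of_mul_eq_one_right hc₂)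
  have hc₁' : c₁ = (α₁ * α₂)⁻¹ := eq_inv_of_mul_eq_one_left hc₁
  have hR : (arithFrobPolyOfSatake ι q 1 ((({α₁, α₂} : Multiset ℂ).map (c₁ * ·)).map (c₂ * ·))).map
      (ι : PadicAlgCl p →+* ℂ) =
      (X - C (((Real.sqrt q : ℝ) : ℂ) * α₂)) * (X - C (((Real.sqrt q : ℝ) : ℂ) * α₁)) := by
    rw [arithFrobPolyOfSatake_one]
    simp only [Multiset.insert_eq_cons, Multiset.map_cons, Multiset.map_singleton, Multiset.prod_cons,
      Multiset.prod_singleton, Polynomial.map_mul, Polynomial.map_sub, map_X, map_C, RingHom.coe_coe,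
      RingEquiv.apply_symm_apply]
    rw [hs, hc₁']
    congr 3
    · field_simp
    · field_simp
  rw [hL, hR, X_sub_C_mul_X_sub_C]
  have hq : ((Real.sqrt q : ℝ) : ℂ) * ((Real.sqrt q : ℝ) : ℂ) = (q : ℂ) := by
    rw [← Complex.ofReal_mul, Real.mul_self_sqrt (Nat.cast_nonneg q), Complex.ofReal_natCast]
  congr 2
  · ring
  · rw [← hq]; ring

/-! ### The stub -/

/-- **Stub 4 of the line `top-degree-exact-control` — the unramified Satake dictionary.** If the
`ℚ̄_p`-point `x` of `𝕋^{S,ord}(𝒰)` (`GL₂` over the imaginary quadratic `F`) is associated with `ρ`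
(arithmetic Frobenius, `heckeFrobPoly`) and its `T_{w,1}, T_{w,2}`-eigenvalues are those of a regular
algebraic cuspidal `π₀` in the normalisation of `HasSatakeParamAt` at almost all `w`, then
`π := (π₀ ⊗ ω_{π₀}⁻¹) ⊗ |det|^{1/2}` (`= π₀^∨ ⊗ |det|^{1/2}` for `GL₂`) is cuspidal, `L`-algebraic, and
satisfies the summit's `SatakeFrobCompatibleAt ι π ρ v` at almost all `v` (module docstring for the
dictionary). [cite: BuzzardGeeLMS2014, Def. 3.1.1 and §5.3] [cite: BorelJacquet1979, 5.7]
[cite: GeeNewton2020, §3.3, Conj. 3.3.2] -/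
theorem stub_satakeDictionary : ∀ (F : Type) [Field F] [NumberField F], NumberField.IsTotallyComplex F → Module.finrank ℚ F = 2 → ∀ (p : ℕ) [Fact p.Prime], p ≠ 2 → ∀ (hcpt : Literature.NumberTheory.Automorphic.isCompact_glFiniteIntegralLevel 2 F) (ι : PadicAlgCl p ≃+* ℂ) (ρ : Literature.NumberTheory.GaloisRepresentations.FramedGaloisRep F (PadicAlgCl p) 2) (𝒰 : Literature.NumberTheory.Automorphic.BigHeckeGLn.TameLevel 2 F p) (x : Literature.NumberTheory.Automorphic.OrdinaryHeckeAlgebraGLn 𝒰 →+* PadicAlgCl p) (π₀ : Literature.NumberTheory.Automorphic.CuspidalAutomorphicRepData 2 F hcpt), 𝒰.IsOrdAssociated x ρ → π₀.1.IsRegularAlgebraic → (∀ᶠ w : IsDedekindDomain.HeightOneSpectrum (NumberField.RingOfIntegers F) in Filter.cofinite, ∃ α : Multiset ℂ, π₀.1.HasSatakeParamAt w α ∧ ι (x (𝒰.ordT w 1)) = ((Real.sqrt (w.residueCard : ℝ) : ℝ) : ℂ) * α.esymm 1 ∧ ι (x (𝒰.ordT w 2)) = α.esymm 2) → ∃ π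 : Literature.NumberTheory.Automorphic.CuspidalAutomorphicRepData 2 F hcpt, π.1.IsLAlgebraic ∧ ∀ᶠ v : IsDedekindDomain.HeightOneSpectrum (NumberField.RingOfIntegers F) in Filter.cofinite, Summit.Langlands.SatakeFrobCompatibleAt ι π.1 ρ v := by
  intro F _ _ _ _ p _ _ hcpt ι ρ 𝒰 x π₀ hass hreg hmatch
  -- the central character `ω` of `π₀` and the twist `π₁ = π₀ ⊗ (ω⁻¹ ∘ det)` (`= π₀^∨`)
  obtain ⟨ω, hωact, hωsat⟩ := π₀.1.exists_centralCharacter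
  obtain ⟨π₁, hW₁, hW₁'⟩ := exists_cuspidalAutomorphicRepData_twist_hecke ω⁻¹ π₀
  have hreg₁ : π₁.1.IsRegularAlgebraic :=
    AutomorphicRepData.IsRegularAlgebraic.of_map_mulChar_detTwist_centralInv hωact hW₁ hW₁' hreg
  have htw₁ := AutomorphicRepData.eventually_hasSatakeParamAt_of_map_mulChar_detTwist ω⁻¹ hW₁ hW₁'
  -- the half twist `π = π₁ ⊗ |det|^{1/2}`, `L`-algebraic
  obtain ⟨χ, π, T', hχ, hW, hW', hT', -, hL⟩ := π₁.exists_twist_isRegular_isLAlgebraic hreg₁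
  refine ⟨π, ⟨T', hT', hL⟩, ?_⟩
  -- almost all places: matching, twist, and `w ∉ S`
  have hbad : ∀ᶠ v : HeightOneSpectrum (𝓞 F) in cofinite, v ∉ 𝒰.bad := by
    rw [Filter.eventually_cofinite]
    simpa only [not_not, Set.setOf_mem_eq] using 𝒰.bad_finite
  filter_upwards [hmatch, htw₁, hbad] with v hv htwv hvbad
  obtain ⟨α, hα, h1, h2⟩ := hv
  obtain ⟨hρunr, hρfrob⟩ := hass v hvbad
  -- `α = {α₁, α₂}` with `α₁ α₂ = ω(ϖ_v) ≠ 0`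
  obtain ⟨α₁, α₂, rfl⟩ := Multiset.card_eq_two.1 hα.card_eq
  obtain ⟨-, hωv⟩ := hωsat hα
  rw [prod_pair] at hωv
  have hprod : α₁ * α₂ ≠ 0 := hωv ▸ valueAtUniformizer_ne_zero ω v
  rw [esymm_one_pair] at h1
  rw [esymm_two_pair] at h2
  -- Satake parameters of `π₁` and `π` at `v`
  have hβ₁ := htwv _ hα
  have hβ := AutomorphicRepData.HasSatakeParamAt.of_map_mulChar_detTwist_of_cpow hχ hW hW' hβ₁
  refine ⟨_, hβ, hρunr, ?_⟩
  -- the Frobenius polynomial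
  have hc₁ : ω⁻¹.valueAtUniformizer v * (α₁ * α₂) = 1 := by
    rw [valueAtUniformizer_inv, hωv, inv_mul_cancel₀ hprod]
  have key := heckeFrobPoly_two_eq_arithFrobPolyOfSatake ι v.residueCard (fun j => x (𝒰.ordT v j)) h1 h2
    (left_ne_zero_of_mul hprod) (right_ne_zero_of_mul hprod) hc₁
    (halfTwist_mul_sqrt (Nat.zero_lt_of_lt v.one_lt_residueCard))
  rw [← key]
  exact hρfrob

end Summit.Langlands.Langlands.Cruxes.ProModularOrdinaryClassical.TopDegreeExactControl
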